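/-
Copyright (c) 2026 the pub-hodgecm-mathlib formalisation cell (harness21).  Prover seat hodgecm-mathlib-K2E1-p13 (g6), Track B ∕ K2-LIT, h413 = `stmt-HodgeConjecture-24833`,
R90-TF section S8 «ContSpec-n½», S8 dealer R90-CS-plan (g3) S8-R246 «`R90S8ResGMidBlockEqBotOfRecordV2U3 :: resGMidBlockτ_eq_bot_of_not_lHalfNeZero_of_record_v2` = THE (V♭)τ
ASSEMBLY IN ONE HEAD»: `¬ LHalfNeZero (ξ.bcη⁻¹·μω)` ⊢ `resGMidBlockτ ξ μω = ⊥`, with the vector half of MW IV.1.11 DISCHARGED (★ p864915), ESTATE T's clauses for each datum's own `Ec`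
taken as (R)′τ's `hEXP` row bytes (★ `hEXP_tauRow_closed'`), (R)′τ's head as the named hypothesis `hRes`, and the per-datum analytic input in its weakest form `hSCALτ` (the tube
factorisation of the second constant-term coefficient through the block's scalar — a sub-clause of (R)′τ's `hSCALrows` and of the coordinate road ★ p864880 + ★ (U1)).
-/
import Summits.HodgeConjecture.HodgeConjecture.Theorems.R90S8ResGMidVanishingResidueOfLettersU3   -- ★ p864915 (this seat): `res_class_eq_zero_of_zero_coeff_residue`; brings ★ p864870 ((V♭) OF RECORD §2 `chiScalarG_three_halves_eq_zero_of_not_lHalfNeZero`, ★ F4, ★ τ-DEFS, `residualSubspace`, `differentiableOn_middleCoefficient_slitPlane_cm_three`)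
import Summits.HodgeConjecture.HodgeConjecture.Theorems.K2E1ConvexDiffCountableConnected           -- ★ (K2E2-p12): `isPreconnected_convex_diff_of_countable` (the slit half-plane is connected)
import HarnessLib

/-!
# R90-TF · S8 «ContSpec-n½» — `R90S8ResGMidBlockEqBotOfRecordV2U3`: (V♭)τ OF RECORD, ED. 2 — `¬ L(½, φ_ξ) ≠ 0 ⟹ resGMidBlockτ ξ μω = ⊥` IN ONE HEAD, the vector half discharged,
# modulo (R)′τ's head `hRes`, (R)′τ's `hEXP` row and the tube factorisation `hSCALτ`

Cell `hodgecm-mathlib`, crux H413 (`stmt-HodgeConjecture-24833`, lane `--supports … --as helper`), route of record `HCCMUnconditional`; R90-TF section S8, socket (V♭)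
`sock_S8_res_midBlock_eq_bot_of_not_LHalfNeZero` (B ED. 7 :406) on the τ-admissible block (ruling J-S8-V♭ «= (α)»).  THEOREMS ONLY (no `def`, no `instance`, no `notation`, no named-fact
hypothesis, no `sorry`; default heartbeats); count-neutral; CLOSES NO SOCKET (OF-RECORD composition, conditional by construction on the displayed hypotheses).

THE MATHEMATICS ([MoeglinWaldspurger1995, IV.1.11, V.3.13]; [Langlands1976, §7]; [Rogawski1990, §13.9 p. 229 (ii)]).  ED. 1 (★ p864870 `resGMidBlockτ_eq_bot_of_not_lHalfNeZero_of_record`) took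
TWO estate letters: `hfacτ` (coordinate factorisation + CT expansion NEAR `3∕2`) and the `Fp`-free vector half `hVEC`.  ED. 2 replaces both:
* the VECTOR HALF is PAID (★ p864915 §1 `res_class_eq_zero_of_zero_coeff_residue`: a residue class in `L²_res(𝔓)` whose constant-term coefficients have zero residue at `3∕2` is `0` — ★ CT-RES,
  ★ KER; left invariance of the residue function ★ `midPoleLetter_apply_quotientSubgroup_mul`), at the pole set `P* := ↑Sp ∪ {Re ≤ 1}` of the datum (`z ∉ P* ↔ z ∈ {1 < Re} ∖ Sp`);
* ESTATE T's clauses (E4) «`Ec z` continuous» and (E2-bd) «joint local bound on compacts» for the datum's OWN continuation `Ec` on the slit plane are (R)′τ's `hEXP` ROW, byte for byte —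
  ★ `hEXP_tauRow_closed'` (K2E1-p12: the exports of the generator ★ p864481 + the identity-theorem bridge ★ `hEXP_tauRow_of_exportsRow`, modulo `hμu`, the ports' frame and `hCO′`);
* the per-datum analytic input is the TUBE FACTORISATION `hSCALτ`: for every τ-admissible datum `(U₀, φ, Ec, Sp)` and every `g`, an amplitude `A` HOLOMORPHIC ON `{1 < Re}` with
  `(CT_{ν₀,𝓕₀}(Ec z)(g) − φ(g)·H(g)^z) ∕ H(g)^{2−z} = A(z)·c(z)` on `{2 < Re}`, `c(z) = L^S(z−1, φ_ξ)ζ^T(2z−2) ∕ (L^S(z, φ_ξ)ζ^T(2z−1))` the block's scalar of ★ F4 — clauses 1+3 of (R)′τ's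
  `hSCALrows` read per `g`, and what the coordinate road gives at pure-type generators (★ p864880's tube clause `Σ_j q_j(z)φ′_j = (ν𝓕)⁻¹·(g ↦ ∫_N φ_z(w₀vg) dν·H(g)^{z−2})`, `q_j = c·a_j`,
  with ★ (U1) `CT(E(φ_z))(g) = φ_z(g) + (ν𝓕)⁻¹∫_N φ_z(w₀vg) dν`: `A_g(z) := Σ_j a_j(z)·φ′_j(g)`).
THE CONTINUATION FROM THE TUBE TO `3∕2` IS DONE HERE (§1): `ψ(·, g) := (CT(Ec ·)(g) − φ(g)H^·)∕H^{2−·}` is holomorphic on `{1<Re} ∖ Sp` (★ `differentiableOn_middleCoefficient_slitPlane_cm_three`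
from the `hEXP` row), `(z−2)(2z−3)·ψ(z, g) = A(z)·G(z)` there (identity theorem on the CONNECTED slit plane ★ `isPreconnected_convex_diff_of_countable`, from the tube where `(z−2)(2z−3)·c = G`,
★ F4), so `(z − 3∕2)·ψ(z, g) → A(3∕2)·G(3∕2)∕(−1) = 0` when `G(3∕2) = 0` — which ★ F4 + `φ_ξ ≠ 1` + `¬ LHalfNeZero φ_ξ` give (★ p864870 §2).
* §1 **`eventually_nhdsNE_not_mem_finset`**, **`tendsto_sub_three_halves_mul_of_slitFactorisation`** — the slit-plane residue computation.
* §2 **HEAD `resGMidBlockτ_eq_bot_of_not_lHalfNeZero_of_record_v2`** (F4 frame, `hφ1`, the CT package `(ν₀, 𝓕₀)`, `𝔓`, `hRes`, `hEXP`, `hSCALτ`) ⊢ `¬ LHalfNeZero (ξ.bcη⁻¹·μω) →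
  resGMidBlockτ ξ μω = ⊥`; **`resGMidBlock_eq_bot_of_not_lHalfNeZero_of_record_v2`** — the socket bytes on `resGMidBlock` under `hW1 : resGMidBlock ≤ resGMidBlockτ` with (R)′τ's LITERAL
  conclusion `hR : resGMidBlock ≤ L²_res(𝔓)` (★ `res_midBlock_le_residual_of_tauAdmissible`) in place of `hRes`; **`lHalfNeZero_of_resGMidBlockτ_ne_bot_of_record_v2`** — contrapositive.
HONEST LABEL: HC_CM is proved only modulo the 7 printed citations (2 remaining named inputs: hLiu418 = `stmt-HodgeConjecture-24832`, h413 = `stmt-HodgeConjecture-24833`) until rung 0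
closes; (V♭)τ is OF RECORD modulo {`hRes` = (R)′τ, `hEXP` = ★ `hEXP_tauRow_closed'`'s residual binders (`hμu`, ports' frame, `hCO′`), `hSCALτ` (payers: K2E2∕K2E4's scalar road of record;
★ p864880 + (U1) at pure types modulo `hunfK` per generator), `hφ1`, F4's frame}; REL ≠ ★ ≠ BUILT; this file asserts no named fact and closes no socket; count-neutral.

## References
* [MoeglinWaldspurger1995] C. Mœglin, J.-L. Waldspurger, *Spectral Decomposition and Eisenstein Series* (1995), IV.1.9–IV.1.11, V.3.13.
* [Langlands1976] R. P. Langlands, *On the Functional Equations Satisfied by Eisenstein Series*, LNM 544 (1976), §7.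
* [Rogawski1990] J. D. Rogawski, *Automorphic Representations of Unitary Groups in Three Variables* (1990), §13.9 p. 229 (ii).
* [Conway1978] J. B. Conway, *Functions of One Complex Variable* (1978), IV §3 (identity theorem).
-/

set_option autoImplicit false
set_option linter.dupNamespace false  -- the mandated namespace `…HodgeConjecture.HodgeConjecture.R90.S8` (LEAD #1 L1) repeats the summit's segment

noncomputable section

open MeasureTheory Measure Set Filter Topology NumberField IsDedekindDomain
open scoped ENNReal NNReal Topology
open Literature.NumberTheory.Automorphic Literature.NumberTheory.Automorphic.UnitaryGroup Literature.NumberTheory.GaloisRepresentations Literature.NumberTheory.LFunctions AdelicGroupData ContRepresentation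
open Literature.NumberTheory.Automorphic.Arthur2013.Leaves.TECR Literature.NumberTheory.Rogawski1990
open Summit.HodgeConjecture.HodgeConjecture.Cruxes.H413.K2E1BorelEisensteinU
open Summit.HodgeConjecture.HodgeConjecture.Cruxes.H413.K2E1CharacterEisensteinU3PairDefs
open Summit.HodgeConjecture.HodgeConjecture.Cruxes.H413.K2E1ChiSectionSpaceU3PairDefs
open Summit.HodgeConjecture.HodgeConjecture.Cruxes.H413.K2E1CuspidalSpectrumUnitary
open Summit.HodgeConjecture.HodgeConjecture.Cruxes.H413.K2E1HeckeLHalfNeZeroDefs (LHalfNeZero)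
open Summit.HodgeConjecture.HodgeConjecture.Cruxes.H413.K2E1ChiIntertwiningScalarEulerQuotientU3CM (exists_differentiableOn_mul_chiScalar_cm_three)
open Summit.HodgeConjecture.HodgeConjecture.Cruxes.H413.K2E1ChiConstantTermHolomorphicCMThree (differentiableOn_middleCoefficient_slitPlane_cm_three)
open Summit.HodgeConjecture.HodgeConjecture.Cruxes.H413.K2E1ConvexDiffCountableConnected (isPreconnected_convex_diff_of_countable)

namespace Summit.HodgeConjecture.HodgeConjecture.R90.S8

/-! ## §1 The slit-plane residue computation: `ψ = A·c` on the tube, `ψ` holomorphic on `{1<Re} ∖ Sp`, `(z−2)(2z−3)·c = G`, `G(3∕2) = 0 ⟹ (z − 3∕2)·ψ → 0` -/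

section Slit

/-- A finite set is eventually avoided on every punctured neighbourhood. [folklore] -/
theorem eventually_nhdsNE_not_mem_finset (Sp : Finset ℂ) (z₀ : ℂ) : ∀ᶠ z in 𝓝[≠] z₀, z ∉ (↑Sp : Set ℂ) := by
  have h1 : ((↑Sp : Set ℂ) \ {z₀})ᶜ ∈ 𝓝 z₀ :=
    (Sp.finite_toSet.subset (Set.sdiff_subset : (↑Sp : Set ℂ) \ {z₀} ⊆ ↑Sp)).isClosed.isOpen_compl.mem_nhds fun h => h.2 rfl
  filter_upwards [mem_nhdsWithin_of_mem_nhds h1, self_mem_nhdsWithin] with z hz hne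
  exact fun hzS => hz ⟨hzS, hne⟩

/-- **THE SLIT-PLANE RESIDUE COMPUTATION AT `3∕2`**: `ψ` holomorphic on `{1 < Re} ∖ Sp` (`Sp` finite, `⊆ {Re ≤ 2}`), `ψ = A·c` on the tube `{2 < Re}` with `A` holomorphic on `{1 < Re}`,
`(z−2)(2z−3)·c = G` on the tube with `G` holomorphic on `{1 < Re}` and `G(3∕2) = 0` ⟹ `(z − 3∕2)·ψ(z) → 0` on `𝓝[≠] (3∕2)`.  PROOF: `(z−2)(2z−3)·ψ = A·G` on the CONNECTED open slit plane
(identity theorem from the base point `3` ★ `isPreconnected_convex_diff_of_countable`), so near `3∕2` `(z − 3∕2)·ψ(z) = A(z)G(z)∕(2(z−2)) → A(3∕2)·G(3∕2)∕(−1) = 0`.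
[cite: MoeglinWaldspurger1995, IV.1.11] [cite: Conway1978, IV §3] -/
theorem tendsto_sub_three_halves_mul_of_slitFactorisation {ψ A c G : ℂ → ℂ} {Sp : Finset ℂ} (hSp : ∀ s ∈ Sp, s.re ≤ 2)
    (hψ : DifferentiableOn ℂ ψ ({z : ℂ | 1 < z.re} \ (↑Sp : Set ℂ))) (hA : DifferentiableOn ℂ A {z : ℂ | 1 < z.re})
    (hfac : ∀ z : ℂ, 2 < z.re → ψ z = A z * c z)
    (hG : DifferentiableOn ℂ G {z : ℂ | 1 < z.re}) (hGeq : ∀ z : ℂ, 2 < z.re → (z - 2) * (2 * z - 3) * c z = G z) (hG32 : G (3 / 2) = 0) :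
    Tendsto (fun z : ℂ => (z - 3 / 2) * ψ z) (𝓝[≠] (3 / 2)) (𝓝 0) := by
  have hO : IsOpen {z : ℂ | 1 < z.re} := isOpen_lt continuous_const Complex.continuous_re
  have hDo : IsOpen ({z : ℂ | 1 < z.re} \ (↑Sp : Set ℂ)) := hO.sdiff Sp.finite_toSet.isClosed
  have hDpc : IsPreconnected ({z : ℂ | 1 < z.re} \ (↑Sp : Set ℂ)) :=
    isPreconnected_convex_diff_of_countable Literature.Topology.Euclidean.one_lt_rank_real_complex (convex_halfSpace_re_gt (1 : ℝ)) hO Sp.countable_toSet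
  have hu : AnalyticOnNhd ℂ (fun z => (z - 2) * (2 * z - 3) * ψ z) ({z : ℂ | 1 < z.re} \ (↑Sp : Set ℂ)) := fun z hz =>
    ((analyticAt_id.sub analyticAt_const).mul ((analyticAt_const.mul analyticAt_id).sub analyticAt_const)).mul (hψ.analyticAt (hDo.mem_nhds hz))
  have hv : AnalyticOnNhd ℂ (fun z => A z * G z) ({z : ℂ | 1 < z.re} \ (↑Sp : Set ℂ)) := fun z hz =>
    (hA.analyticAt (hO.mem_nhds hz.1)).mul (hG.analyticAt (hO.mem_nhds hz.1))
  have h3 : (3 : ℂ) ∈ {z : ℂ | 1 < z.re} \ (↑Sp : Set ℂ) := by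
    refine ⟨by norm_num, fun h => ?_⟩
    have h' := hSp _ (Finset.mem_coe.1 h)
    norm_num at h'
  have heq : (fun z => (z - 2) * (2 * z - 3) * ψ z) =ᶠ[𝓝 (3 : ℂ)] fun z => A z * G z := by
    filter_upwards [(isOpen_lt continuous_const Complex.continuous_re).mem_nhds (show (3 : ℂ) ∈ {z : ℂ | 2 < z.re} by norm_num)] with z hz
    rw [hfac z hz, ← hGeq z hz]
    ring
  have hEqOn := hu.eqOn_of_preconnected_of_eventuallyEq hv hDpc h3 heq
  have h32 : (3 : ℂ) / 2 ∈ {z : ℂ | 1 < z.re} := by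
    rw [mem_setOf_eq, Complex.div_ofNat_re]
    norm_num
  -- the limit of the right-hand side `A·G ∕ (2(z−2))` at `3∕2` is `0`
  have hlim : Tendsto (fun z : ℂ => A z * G z / (2 * (z - 2))) (𝓝[≠] ((3 : ℂ) / 2)) (𝓝 0) := by
    have hc : ContinuousAt (fun z : ℂ => A z * G z / (2 * (z - 2))) ((3 : ℂ) / 2) :=
      (((hA.differentiableAt (hO.mem_nhds h32)).continuousAt).mul ((hG.differentiableAt (hO.mem_nhds h32)).continuousAt)).div
        ((continuous_const.mul (continuous_id.sub continuous_const)).continuousAt) (by norm_num)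
    have h0 : A (3 / 2) * G (3 / 2) / (2 * (3 / 2 - 2)) = 0 := by rw [hG32, mul_zero, zero_div]
    have h := hc.tendsto.mono_left (nhdsWithin_le_nhds (s := ({(3 : ℂ) / 2} : Set ℂ)ᶜ))
    rwa [h0] at h
  refine hlim.congr' ?_
  filter_upwards [mem_nhdsWithin_of_mem_nhds (hO.mem_nhds h32), eventually_nhdsNE_not_mem_finset Sp _,
    mem_nhdsWithin_of_mem_nhds (eventually_ne_nhds (show (3 : ℂ) / 2 ≠ 2 by norm_num))] with z hz hzS hz2
  have h : (z - 2) * (2 * z - 3) * ψ z = A z * G z := hEqOn ⟨hz, hzS⟩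
  have hne : (2 : ℂ) * (z - 2) ≠ 0 := mul_ne_zero two_ne_zero (sub_ne_zero.2 hz2)
  rw [div_eq_iff hne]
  linear_combination -h

end Slit

/-! ## §2 HEADS: (V♭)τ OF RECORD ED. 2 on `resGMidBlockτ`; the socket bytes on `resGMidBlock` under `hW1` with (R)′τ's literal conclusion; the contrapositive -/

section Record

variable (L : Type) [Field L] [NumberField L] [IsCMField L]
  [MeasurableSpace (quasiSplit (↥(maximalRealSubfield L)) L (IsCMField.complexConj L) 3).Adelic] [BorelSpace (quasiSplit (↥(maximalRealSubfield L)) L (IsCMField.complexConj L) 3).Adelic]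
  (μ : Measure (quasiSplit (↥(maximalRealSubfield L)) L (IsCMField.complexConj L) 3).automorphicQuotient)
  [(quasiSplit (↥(maximalRealSubfield L)) L (IsCMField.complexConj L) 3).IsAutomorphicMeasure μ]
  (ξ : OneDimAutRepH L) (μω : HeckeCharacter L)

/-- **(V♭)τ OF RECORD, ED. 2 — `¬ LHalfNeZero (ξ.bcη⁻¹·μω) → resGMidBlockτ ξ μω = ⊥` IN ONE HEAD.**  Frame: ★ F4's data for `φ_ξ := ξ.bcη⁻¹·μω` (unitary, trivial on the positive reals,
unramified off the finite `S`), the finite `T`, `hφ1 : φ_ξ ≠ 1`; one normalised Heisenberg CT package `(ν₀, 𝓕₀)`; a Borel parabolic datum `𝔓` with radical `N(𝔸)`.  Hypotheses BY NAME: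
**`hRes`** — (R)′τ: the τ-admissible middle block lies in `L²_res(𝔓)` (★ `res_midBlock_le_residual_of_tauAdmissible` composed with ★ `toSubmodule_resGMidBlockτ_le`); **`hEXP`** — (R)′τ's
`hEXP` ROW, byte for byte: (E4) + (E2-bd) for the datum's own `Ec` on `{1 < Re} ∖ Sp` (:= ★ `hEXP_tauRow_closed' L μ νG ν h𝓕N h𝓕c h𝓕₀ hβ hμZ μa μf ξ μω hμu hCO′`); **`hSCALτ`** — for every
τ-admissible datum and every `g`, the tube factorisation `(CT_{ν₀,𝓕₀}(Ec z)(g) − φ(g)H(g)^z)∕H(g)^{2−z} = A(z)·c(z)` on `{2 < Re}` with `A` holomorphic on `{1 < Re}`.  THEN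
`¬ LHalfNeZero φ_ξ → resGMidBlockτ ξ μω = ⊥`: ★ F4 + §2 of ★ p864870 give `G(3∕2) = 0`; per datum `ψ := (CT − φH^z)∕H^{2−z}` is holomorphic on the slit plane (★, from `hEXP`), so §1 gives
zero residue of `ψ(·, g)` at `3∕2` for every `g`; ★ p864915 §1 (CT-RES + KER, with `hRes` and the left invariance ★ `midPoleLetter_apply_quotientSubgroup_mul`) kills the generator's class;
minimality of the τ-block. [cite: MoeglinWaldspurger1995, IV.1.11, V.3.13] [cite: Langlands1976, §7] [cite: Rogawski1990, §13.9 p. 229 (ii)] -/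
theorem resGMidBlockτ_eq_bot_of_not_lHalfNeZero_of_record_v2
    -- ★ F4's frame for `φ := ξ.bcη⁻¹·μω`, `η := 1`
    (hφu : (ξ.bcη⁻¹ * μω).IsUnitary) (hφA : ∀ t : ℝ≥0ˣ, (ξ.bcη⁻¹ * μω) (posRealIdele L t) = 1)
    {S : Set (HeightOneSpectrum (𝓞 L))} (hS : S.Finite) (hurφ : ∀ w ∉ S, (ξ.bcη⁻¹ * μω).IsUnramifiedAt w)
    {T : Set (HeightOneSpectrum (𝓞 ↥(maximalRealSubfield L)))} (hT : T.Finite) (hurη : ∀ v ∉ T, (1 : HeckeCharacter ↥(maximalRealSubfield L)).IsUnramifiedAt v)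
    (hφ1 : ξ.bcη⁻¹ * μω ≠ 1)
    -- the normalised Heisenberg CT package
    (ν₀ : Measure ↥(adelicUnipotent (↥(maximalRealSubfield L)) L (IsCMField.complexConj L) 3)) [ν₀.IsHaarMeasure]
    {𝓕₀ : Set ↥(adelicUnipotent (↥(maximalRealSubfield L)) L (IsCMField.complexConj L) 3)}
    (h𝓕₀ : IsFundamentalDomain ↥(rationalUnipotent (↥(maximalRealSubfield L)) L (IsCMField.complexConj L) 3) 𝓕₀ ν₀) (h𝓕₀c : IsCompact (closure 𝓕₀))
    (h𝓕₀0 : ν₀ 𝓕₀ ≠ 0) (h𝓕₀top : ν₀ 𝓕₀ ≠ ∞)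
    -- the Borel parabolic datum of `L²_res`
    (𝔓 : (quasiSplit (↥(maximalRealSubfield L)) L (IsCMField.complexConj L) 3).ParabolicUnipotentData)
    (h𝔓 : ∀ j : 𝔓.ι, 𝔓.radical j = adelicUnipotent (↥(maximalRealSubfield L)) L (IsCMField.complexConj L) 3)
    -- (R)′τ: the τ-admissible middle block is residual
    (hRes : (resGMidBlockτ L μ ξ μω).toSubmodule ≤ (residualSubspace (quasiSplit (↥(maximalRealSubfield L)) L (IsCMField.complexConj L) 3) μ 𝔓).toSubmodule)
    -- (R)′τ's `hEXP` ROW: ESTATE T's (E4) + (E2-bd) for the datum's own `Ec` on the slit plane (★ `hEXP_tauRow_closed'`)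
    (hEXP : ∀ (U₀ : Subgroup ↥(finAdelic (↥(maximalRealSubfield L)) L (IsCMField.complexConj L) 3 ((StdForm.antidiagonal 3).over L))) (_ : IsTauLevel L U₀)
      (φ : (quasiSplit (↥(maximalRealSubfield L)) L (IsCMField.complexConj L) 3).Adelic → ℂ) (_ : φ ∈ chiSectionSpacePair (ξ.bcη⁻¹ * ξ.bcψ⁻¹ * μω) ξ.ψ (tauLevel L U₀) ((1 : ↥(tauLevel L U₀) →* ℂ) : ↥(tauLevel L U₀) → ℂ)) (_ : Continuous φ)
      (_ : IsArchFinite L φ)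
      (Ec : ℂ → (quasiSplit (↥(maximalRealSubfield L)) L (IsCMField.complexConj L) 3).Adelic → ℂ) (Sp : Finset ℂ) (_ : ∀ s ∈ Sp, s.im = 0 ∧ 1 < s.re ∧ s.re ≤ 2)
      (_ : ∀ g, DifferentiableOn ℂ (fun z => Ec z g) ({z : ℂ | 1 < z.re} \ (↑Sp : Set ℂ)))
      (_ : ∀ z : ℂ, 2 < z.re → Ec z = eisensteinSeriesU (flatSectionU φ z))
      (Fp : (quasiSplit (↥(maximalRealSubfield L)) L (IsCMField.complexConj L) 3).Adelic → ℂ → ℂ) (_ : ∀ g, AnalyticAt ℂ (Fp g) ((3 : ℂ) / 2))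
      (_ : ∀ g, Fp g =ᶠ[𝓝[≠] ((3 : ℂ) / 2)] fun z => (z - (3 : ℂ) / 2) * Ec z g)
      (f : (quasiSplit (↥(maximalRealSubfield L)) L (IsCMField.complexConj L) 3).L2 μ) (_ : (f : (quasiSplit (↥(maximalRealSubfield L)) L (IsCMField.complexConj L) 3).automorphicQuotient → ℂ) =ᵐ[μ] fun x => Fp (Quotient.out (x : (quasiSplit (↥(maximalRealSubfield L)) L (IsCMField.complexConj L) 3).Adelic ⧸ (quasiSplit (↥(maximalRealSubfield L)) L (IsCMField.complexConj L) 3).quotientSubgroup))⁻¹ ((3 : ℂ) / 2)), (∀ z ∈ ({z : ℂ | 1 < z.re} \ (↑Sp : Set ℂ)), Continuous (Ec z)) ∧ (∀ z₁ ∈ ({z : ℂ | 1 < z.re} \ (↑Sp : Set ℂ)), ∀ K : Set (quasiSplit (↥(maximalRealSubfield L)) L (IsCMField.complexConj L) 3).Adelic, IsCompact K → ∃ V ∈ 𝓝 z₁, ∃ M : ℝ, ∀ z ∈ V, ∀ g ∈ K, ‖Ec z g‖ ≤ M))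
    -- `hSCALτ`: the tube factorisation of the second CT coefficient through the block's scalar, per τ-admissible datum and per `g`
    (hSCALτ : ∀ (U₀ : Subgroup ↥(finAdelic (↥(maximalRealSubfield L)) L (IsCMField.complexConj L) 3 ((StdForm.antidiagonal 3).over L))), IsTauLevel L U₀ →
      ∀ φ ∈ chiSectionSpacePair (ξ.bcη⁻¹ * ξ.bcψ⁻¹ * μω) ξ.ψ (tauLevel L U₀) ((1 : ↥(tauLevel L U₀) →* ℂ) : ↥(tauLevel L U₀) → ℂ), Continuous φ → IsArchFinite L φ →
        ∀ (Ec : ℂ → (quasiSplit (↥(maximalRealSubfield L)) L (IsCMField.complexConj L) 3).Adelic → ℂ) (Sp : Finset ℂ), (∀ s ∈ Sp, s.im = 0 ∧ 1 < s.re ∧ s.re ≤ 2) →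
          (∀ g, DifferentiableOn ℂ (fun z => Ec z g) ({z : ℂ | 1 < z.re} \ (↑Sp : Set ℂ))) → (∀ z : ℂ, 2 < z.re → Ec z = eisensteinSeriesU (flatSectionU φ z)) →
            ∀ g : (quasiSplit (↥(maximalRealSubfield L)) L (IsCMField.complexConj L) 3).Adelic, ∃ A : ℂ → ℂ, DifferentiableOn ℂ A {z : ℂ | 1 < z.re} ∧
              ∀ z : ℂ, 2 < z.re → (borelConstantTerm ν₀ 𝓕₀ (Ec z) g - φ g * (((borelHeight g : ℝ≥0) : ℝ) : ℂ) ^ z) / (((borelHeight g : ℝ≥0) : ℝ) : ℂ) ^ (2 - z) = A z *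
                ((partialStandardL S (fun w => {(ξ.bcη⁻¹ * μω).valueAtUniformizer w}) (z - 1) * partialStandardL T (fun v => {(1 : HeckeCharacter ↥(maximalRealSubfield L)).valueAtUniformizer v}) (2 * z - 2)) /
                  (partialStandardL S (fun w => {(ξ.bcη⁻¹ * μω).valueAtUniformizer w}) z * partialStandardL T (fun v => {(1 : HeckeCharacter ↥(maximalRealSubfield L)).valueAtUniformizer v}) (2 * z - 1)))) :
    ¬ LHalfNeZero (ξ.bcη⁻¹ * μω) → resGMidBlockτ L μ ξ μω = ⊥ := by
  intro hL
  -- ★ F4 for `(φ, η) := (ξ.bcη⁻¹·μω, 1)`: the scalar weight identity and `G(3∕2) = 0`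
  obtain ⟨G, hG, hGeq, -, hG0, hG32⟩ := exists_differentiableOn_mul_chiScalar_cm_three L hφu hφA hS hurφ HeckeCharacter.isUnitary_one
    (fun t => by rw [HeckeCharacter.one_apply]) hT hurη
  have hG32' : G (3 / 2) = 0 := chiScalarG_three_halves_eq_zero_of_not_lHalfNeZero hG0 hG32 hφ1 hL
  have hO : IsOpen {z : ℂ | 1 < z.re} := isOpen_lt continuous_const Complex.continuous_re
  have h32 : (3 : ℂ) / 2 ∈ {z : ℂ | 1 < z.re} := by
    rw [mem_setOf_eq, Complex.div_ofNat_re]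
    norm_num
  refine le_bot_iff.1 (resGMidBlockτ_le L μ ξ μω ⊥ fun U₀ hU₀ => ?_)
  -- every τ-admissible generator class at the level `U₀` vanishes
  have hgen : resGMidAtomGenτ L μ ξ μω U₀ ⊆ {0} := by
    rintro f ⟨φ, hφ, hφc, hφa, Ec, Sp, hSp, hhol, hEis, Fp, hFp, hFpE, hf⟩
    obtain ⟨hE4, hEbd⟩ := hEXP U₀ hU₀ φ hφ hφc hφa Ec Sp hSp hhol hEis Fp hFp hFpE f hf
    -- the pole set `P* := ↑Sp ∪ {Re ≤ 1}` of the datum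
    have hDo : IsOpen ({z : ℂ | 1 < z.re} \ (↑Sp : Set ℂ)) := hO.sdiff Sp.finite_toSet.isClosed
    have hPiff : ∀ z : ℂ, z ∉ ((↑Sp : Set ℂ) ∪ {z : ℂ | z.re ≤ 1}) ↔ z ∈ ({z : ℂ | 1 < z.re} \ (↑Sp : Set ℂ)) := fun z => by
      simp only [mem_union, mem_setOf_eq, Set.mem_sdiff, not_or, not_le]
      exact and_comm
    have hPdisc : ∀ᶠ s in 𝓝[≠] ((3 : ℂ) / 2), s ∉ ((↑Sp : Set ℂ) ∪ {z : ℂ | z.re ≤ 1}) := by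
      filter_upwards [mem_nhdsWithin_of_mem_nhds (hO.mem_nhds h32), eventually_nhdsNE_not_mem_finset Sp _] with s hs hsS
      exact (hPiff s).2 ⟨hs, hsS⟩
    have hEcA : ∀ g (z : ℂ), z ∉ ((↑Sp : Set ℂ) ∪ {z : ℂ | z.re ≤ 1}) → AnalyticAt ℂ (fun z => Ec z g) z := fun g z hz =>
      (hhol g).analyticAt (hDo.mem_nhds ((hPiff z).1 hz))
    have hEcc : ∀ z : ℂ, z ∉ ((↑Sp : Set ℂ) ∪ {z : ℂ | z.re ≤ 1}) → Continuous (Ec z) := fun z hz => hE4 z ((hPiff z).1 hz)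
    have hE2bd : ∀ z₁ : ℂ, z₁ ∉ ((↑Sp : Set ℂ) ∪ {z : ℂ | z.re ≤ 1}) → ∀ K : Set (quasiSplit (↥(maximalRealSubfield L)) L (IsCMField.complexConj L) 3).Adelic, IsCompact K →
        ∃ V ∈ 𝓝 z₁, ∃ M : ℝ, ∀ z ∈ V, ∀ g ∈ K, ‖Ec z g‖ ≤ M := fun z₁ hz₁ K hK => hEbd z₁ ((hPiff z₁).1 hz₁) K hK
    -- the second CT coefficient `ψ`, DEFINED from the constant term; the ℓ-CT shape holds identically (`H(g) > 0`)
    have hH0 : ∀ g : (quasiSplit (↥(maximalRealSubfield L)) L (IsCMField.complexConj L) 3).Adelic, ∀ z : ℂ, (((borelHeight g : ℝ≥0) : ℝ) : ℂ) ^ z ≠ 0 := fun g z h =>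
      (Complex.ofReal_ne_zero.2 (NNReal.coe_pos.2 (borelHeight_pos g)).ne') ((Complex.cpow_eq_zero_iff _ _).1 h).1
    have hCT : ∀ᶠ z in 𝓝[≠] ((3 : ℂ) / 2), ∀ g : (quasiSplit (↥(maximalRealSubfield L)) L (IsCMField.complexConj L) 3).Adelic,
        borelConstantTerm ν₀ 𝓕₀ (Ec z) g = φ g * (((borelHeight g : ℝ≥0) : ℝ) : ℂ) ^ z +
          (fun (z : ℂ) (g : (quasiSplit (↥(maximalRealSubfield L)) L (IsCMField.complexConj L) 3).Adelic) =>
            (borelConstantTerm ν₀ 𝓕₀ (Ec z) g - φ g * (((borelHeight g : ℝ≥0) : ℝ) : ℂ) ^ z) / (((borelHeight g : ℝ≥0) : ℝ) : ℂ) ^ (2 - z)) z g * (((borelHeight g : ℝ≥0) : ℝ) : ℂ) ^ (2 - z) :=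
      Filter.Eventually.of_forall fun z g => by
        dsimp only
        rw [div_mul_cancel₀ _ (hH0 g (2 - z))]
        ring
    -- `ψ(·, g)` is holomorphic on the slit plane (★, from the `hEXP` row), so §1 gives its zero residue at `3∕2` for every `g`
    have hψhol := differentiableOn_middleCoefficient_slitPlane_cm_three L Ec Sp hhol hE4 hEbd ν₀ h𝓕₀ h𝓕₀c φ
      (fun (z : ℂ) (g : (quasiSplit (↥(maximalRealSubfield L)) L (IsCMField.complexConj L) 3).Adelic) =>
        (borelConstantTerm ν₀ 𝓕₀ (Ec z) g - φ g * (((borelHeight g : ℝ≥0) : ℝ) : ℂ) ^ z) / (((borelHeight g : ℝ≥0) : ℝ) : ℂ) ^ (2 - z)) fun _ _ _ => rfl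
    have hψ0 : ∀ g : (quasiSplit (↥(maximalRealSubfield L)) L (IsCMField.complexConj L) 3).Adelic,
        Tendsto (fun z : ℂ => (z - (3 : ℂ) / 2) *
          (fun (z : ℂ) (g : (quasiSplit (↥(maximalRealSubfield L)) L (IsCMField.complexConj L) 3).Adelic) =>
            (borelConstantTerm ν₀ 𝓕₀ (Ec z) g - φ g * (((borelHeight g : ℝ≥0) : ℝ) : ℂ) ^ z) / (((borelHeight g : ℝ≥0) : ℝ) : ℂ) ^ (2 - z)) z g) (𝓝[≠] ((3 : ℂ) / 2)) (𝓝 0) := fun g => by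
      obtain ⟨A, hA, hfac⟩ := hSCALτ U₀ hU₀ φ hφ hφc hφa Ec Sp hSp hhol hEis g
      exact tendsto_sub_three_halves_mul_of_slitFactorisation (fun s hs => (hSp s hs).2.2) (hψhol g) hA hfac hG hGeq hG32'
    -- left invariance of the residue function; the class lies in `L²_res(𝔓)` ((R)′τ); ★ p864915 §1
    have hinv := midPoleLetter_apply_quotientSubgroup_mul L (isChiSectionPair_of_mem hφ) ξ.hψ (fun s hs => (hSp s hs).1) hhol hEis
      (z₀ := (3 : ℂ) / 2) (by norm_num) (by norm_num) hFp hFpE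
    have hfres : f ∈ (residualSubspace (quasiSplit (↥(maximalRealSubfield L)) L (IsCMField.complexConj L) 3) μ 𝔓).toSubmodule :=
      hRes (resGMidAtomτ_le_resGMidBlockτ L μ ξ μω hU₀ (subset_resGMidAtomτ L μ ξ μω U₀ ⟨φ, hφ, hφc, hφa, Ec, Sp, hSp, hhol, hEis, Fp, hFp, hFpE, hf⟩))
    exact Set.mem_singleton_iff.2
      (res_class_eq_zero_of_zero_coeff_residue L μ ν₀ h𝓕₀ h𝓕₀c h𝓕₀0 h𝓕₀top Ec _ hPdisc hEcA hEcc hE2bd Fp hFp hFpE hinv φ _ hCT hψ0 𝔓 h𝔓 hf hfres)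
  have hspan : Submodule.span ℂ (resGMidAtomGenτ L μ ξ μω U₀) = ⊥ :=
    Submodule.span_eq_bot.2 fun f hf => Set.mem_singleton_iff.1 (hgen hf)
  have hcl : IsClosed ((⊥ : Submodule ℂ ((quasiSplit (↥(maximalRealSubfield L)) L (IsCMField.complexConj L) 3).L2 μ)) : Set ((quasiSplit (↥(maximalRealSubfield L)) L (IsCMField.complexConj L) 3).L2 μ)) := by
    rw [Submodule.bot_coe]; exact isClosed_singleton
  rw [resGMidAtomτ_def, hspan, hcl.submodule_topologicalClosure_eq, ClosedSubrep.toSubmodule_bot]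

/-- **(V♭) OF RECORD, ED. 2 — THE SOCKET BYTES `¬ LHalfNeZero (ξ.bcη⁻¹ * μω) → resGMidBlock L μ ξ μω = ⊥`** modulo `hW1 : resGMidBlock ≤ resGMidBlockτ` (★ typ2 T4) and (R)′τ's LITERAL
conclusion `hR : resGMidBlock ξ μω ≤ L²_res(𝔓)` (★ `res_midBlock_le_residual_of_tauAdmissible`; it yields `hRes` through ★ `toSubmodule_resGMidBlockτ_le`), with the same `hEXP` row and
`hSCALτ`. [cite: MoeglinWaldspurger1995, IV.1.11, V.3.13] [cite: Langlands1976, §7] [cite: Rogawski1990, §13.9 p. 229 (ii)] -/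
theorem resGMidBlock_eq_bot_of_not_lHalfNeZero_of_record_v2 (hW1 : resGMidBlock L μ ξ μω ≤ resGMidBlockτ L μ ξ μω)
    (hφu : (ξ.bcη⁻¹ * μω).IsUnitary) (hφA : ∀ t : ℝ≥0ˣ, (ξ.bcη⁻¹ * μω) (posRealIdele L t) = 1)
    {S : Set (HeightOneSpectrum (𝓞 L))} (hS : S.Finite) (hurφ : ∀ w ∉ S, (ξ.bcη⁻¹ * μω).IsUnramifiedAt w)
    {T : Set (HeightOneSpectrum (𝓞 ↥(maximalRealSubfield L)))} (hT : T.Finite) (hurη : ∀ v ∉ T, (1 : HeckeCharacter ↥(maximalRealSubfield L)).IsUnramifiedAt v)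
    (hφ1 : ξ.bcη⁻¹ * μω ≠ 1)
    (ν₀ : Measure ↥(adelicUnipotent (↥(maximalRealSubfield L)) L (IsCMField.complexConj L) 3)) [ν₀.IsHaarMeasure]
    {𝓕₀ : Set ↥(adelicUnipotent (↥(maximalRealSubfield L)) L (IsCMField.complexConj L) 3)}
    (h𝓕₀ : IsFundamentalDomain ↥(rationalUnipotent (↥(maximalRealSubfield L)) L (IsCMField.complexConj L) 3) 𝓕₀ ν₀) (h𝓕₀c : IsCompact (closure 𝓕₀))
    (h𝓕₀0 : ν₀ 𝓕₀ ≠ 0) (h𝓕₀top : ν₀ 𝓕₀ ≠ ∞)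
    (𝔓 : (quasiSplit (↥(maximalRealSubfield L)) L (IsCMField.complexConj L) 3).ParabolicUnipotentData)
    (h𝔓 : ∀ j : 𝔓.ι, 𝔓.radical j = adelicUnipotent (↥(maximalRealSubfield L)) L (IsCMField.complexConj L) 3)
    -- (R)′τ's literal conclusion
    (hR : resGMidBlock L μ ξ μω ≤ residualSubspace (quasiSplit (↥(maximalRealSubfield L)) L (IsCMField.complexConj L) 3) μ 𝔓)
    (hEXP : ∀ (U₀ : Subgroup ↥(finAdelic (↥(maximalRealSubfield L)) L (IsCMField.complexConj L) 3 ((StdForm.antidiagonal 3).over L))) (_ : IsTauLevel L U₀)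
      (φ : (quasiSplit (↥(maximalRealSubfield L)) L (IsCMField.complexConj L) 3).Adelic → ℂ) (_ : φ ∈ chiSectionSpacePair (ξ.bcη⁻¹ * ξ.bcψ⁻¹ * μω) ξ.ψ (tauLevel L U₀) ((1 : ↥(tauLevel L U₀) →* ℂ) : ↥(tauLevel L U₀) → ℂ)) (_ : Continuous φ)
      (_ : IsArchFinite L φ)
      (Ec : ℂ → (quasiSplit (↥(maximalRealSubfield L)) L (IsCMField.complexConj L) 3).Adelic → ℂ) (Sp : Finset ℂ) (_ : ∀ s ∈ Sp, s.im = 0 ∧ 1 < s.re ∧ s.re ≤ 2)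
      (_ : ∀ g, DifferentiableOn ℂ (fun z => Ec z g) ({z : ℂ | 1 < z.re} \ (↑Sp : Set ℂ)))
      (_ : ∀ z : ℂ, 2 < z.re → Ec z = eisensteinSeriesU (flatSectionU φ z))
      (Fp : (quasiSplit (↥(maximalRealSubfield L)) L (IsCMField.complexConj L) 3).Adelic → ℂ → ℂ) (_ : ∀ g, AnalyticAt ℂ (Fp g) ((3 : ℂ) / 2))
      (_ : ∀ g, Fp g =ᶠ[𝓝[≠] ((3 : ℂ) / 2)] fun z => (z - (3 : ℂ) / 2) * Ec z g)
      (f : (quasiSplit (↥(maximalRealSubfield L)) L (IsCMField.complexConj L) 3).L2 μ) (_ : (f : (quasiSplit (↥(maximalRealSubfield L)) L (IsCMField.complexConj L) 3).automorphicQuotient → ℂ) =ᵐ[μ] fun x => Fp (Quotient.out (x : (quasiSplit (↥(maximalRealSubfield L)) L (IsCMField.complexConj L) 3).Adelic ⧸ (quasiSplit (↥(maximalRealSubfield L)) L (IsCMField.complexConj L) 3).quotientSubgroup))⁻¹ ((3 : ℂ) / 2)), (∀ z ∈ ({z : ℂ | 1 < z.re} \ (↑Sp : Set ℂ)), Continuous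 (Ec z)) ∧ (∀ z₁ ∈ ({z : ℂ | 1 < z.re} \ (↑Sp : Set ℂ)), ∀ K : Set (quasiSplit (↥(maximalRealSubfield L)) L (IsCMField.complexConj L) 3).Adelic, IsCompact K → ∃ V ∈ 𝓝 z₁, ∃ M : ℝ, ∀ z ∈ V, ∀ g ∈ K, ‖Ec z g‖ ≤ M))
    (hSCALτ : ∀ (U₀ : Subgroup ↥(finAdelic (↥(maximalRealSubfield L)) L (IsCMField.complexConj L) 3 ((StdForm.antidiagonal 3).over L))), IsTauLevel L U₀ →
      ∀ φ ∈ chiSectionSpacePair (ξ.bcη⁻¹ * ξ.bcψ⁻¹ * μω) ξ.ψ (tauLevel L U₀) ((1 : ↥(tauLevel L U₀) →* ℂ) : ↥(tauLevel L U₀) → ℂ), Continuous φ → IsArchFinite L φ →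
        ∀ (Ec : ℂ → (quasiSplit (↥(maximalRealSubfield L)) L (IsCMField.complexConj L) 3).Adelic → ℂ) (Sp : Finset ℂ), (∀ s ∈ Sp, s.im = 0 ∧ 1 < s.re ∧ s.re ≤ 2) →
          (∀ g, DifferentiableOn ℂ (fun z => Ec z g) ({z : ℂ | 1 < z.re} \ (↑Sp : Set ℂ))) → (∀ z : ℂ, 2 < z.re → Ec z = eisensteinSeriesU (flatSectionU φ z)) →
            ∀ g : (quasiSplit (↥(maximalRealSubfield L)) L (IsCMField.complexConj L) 3).Adelic, ∃ A : ℂ → ℂ, DifferentiableOn ℂ A {z : ℂ | 1 < z.re} ∧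
              ∀ z : ℂ, 2 < z.re → (borelConstantTerm ν₀ 𝓕₀ (Ec z) g - φ g * (((borelHeight g : ℝ≥0) : ℝ) : ℂ) ^ z) / (((borelHeight g : ℝ≥0) : ℝ) : ℂ) ^ (2 - z) = A z *
                ((partialStandardL S (fun w => {(ξ.bcη⁻¹ * μω).valueAtUniformizer w}) (z - 1) * partialStandardL T (fun v => {(1 : HeckeCharacter ↥(maximalRealSubfield L)).valueAtUniformizer v}) (2 * z - 2)) /
                  (partialStandardL S (fun w => {(ξ.bcη⁻¹ * μω).valueAtUniformizer w}) z * partialStandardL T (fun v => {(1 : HeckeCharacter ↥(maximalRealSubfield L)).valueAtUniformizer v}) (2 * z - 1)))) :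
    ¬ LHalfNeZero (ξ.bcη⁻¹ * μω) → resGMidBlock L μ ξ μω = ⊥ := fun hL =>
  le_bot_iff.1 (hW1.trans (le_of_eq (resGMidBlockτ_eq_bot_of_not_lHalfNeZero_of_record_v2 L μ ξ μω hφu hφA hS hurφ hT hurη hφ1 ν₀ h𝓕₀ h𝓕₀c h𝓕₀0 h𝓕₀top 𝔓 h𝔓
    ((toSubmodule_resGMidBlockτ_le L μ ξ μω).trans (ClosedSubrep.toSubmodule_le_iff.2 hR)) hEXP hSCALτ hL)))

/-- **CONTRAPOSITIVE OF RECORD, ED. 2 — a non-zero τ-admissible middle block forces `L(½, φ_ξ) ≠ 0`** (modulo `hRes`, the `hEXP` row and `hSCALτ`), the shape ★ F2_qs's index passage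
consumes for #2♯. [cite: Rogawski1990, §13.9 p. 229 (ii)] [cite: Langlands1976, §7] -/
theorem lHalfNeZero_of_resGMidBlockτ_ne_bot_of_record_v2
    (hφu : (ξ.bcη⁻¹ * μω).IsUnitary) (hφA : ∀ t : ℝ≥0ˣ, (ξ.bcη⁻¹ * μω) (posRealIdele L t) = 1)
    {S : Set (HeightOneSpectrum (𝓞 L))} (hS : S.Finite) (hurφ : ∀ w ∉ S, (ξ.bcη⁻¹ * μω).IsUnramifiedAt w)
    {T : Set (HeightOneSpectrum (𝓞 ↥(maximalRealSubfield L)))} (hT : T.Finite) (hurη : ∀ v ∉ T, (1 : HeckeCharacter ↥(maximalRealSubfield L)).IsUnramifiedAt v)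
    (hφ1 : ξ.bcη⁻¹ * μω ≠ 1)
    (ν₀ : Measure ↥(adelicUnipotent (↥(maximalRealSubfield L)) L (IsCMField.complexConj L) 3)) [ν₀.IsHaarMeasure]
    {𝓕₀ : Set ↥(adelicUnipotent (↥(maximalRealSubfield L)) L (IsCMField.complexConj L) 3)}
    (h𝓕₀ : IsFundamentalDomain ↥(rationalUnipotent (↥(maximalRealSubfield L)) L (IsCMField.complexConj L) 3) 𝓕₀ ν₀) (h𝓕₀c : IsCompact (closure 𝓕₀))
    (h𝓕₀0 : ν₀ 𝓕₀ ≠ 0) (h𝓕₀top : ν₀ 𝓕₀ ≠ ∞)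
    (𝔓 : (quasiSplit (↥(maximalRealSubfield L)) L (IsCMField.complexConj L) 3).ParabolicUnipotentData)
    (h𝔓 : ∀ j : 𝔓.ι, 𝔓.radical j = adelicUnipotent (↥(maximalRealSubfield L)) L (IsCMField.complexConj L) 3)
    (hRes : (resGMidBlockτ L μ ξ μω).toSubmodule ≤ (residualSubspace (quasiSplit (↥(maximalRealSubfield L)) L (IsCMField.complexConj L) 3) μ 𝔓).toSubmodule)
    (hEXP : ∀ (U₀ : Subgroup ↥(finAdelic (↥(maximalRealSubfield L)) L (IsCMField.complexConj L) 3 ((StdForm.antidiagonal 3).over L))) (_ : IsTauLevel L U₀)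
      (φ : (quasiSplit (↥(maximalRealSubfield L)) L (IsCMField.complexConj L) 3).Adelic → ℂ) (_ : φ ∈ chiSectionSpacePair (ξ.bcη⁻¹ * ξ.bcψ⁻¹ * μω) ξ.ψ (tauLevel L U₀) ((1 : ↥(tauLevel L U₀) →* ℂ) : ↥(tauLevel L U₀) → ℂ)) (_ : Continuous φ)
      (_ : IsArchFinite L φ)
      (Ec : ℂ → (quasiSplit (↥(maximalRealSubfield L)) L (IsCMField.complexConj L) 3).Adelic → ℂ) (Sp : Finset ℂ) (_ : ∀ s ∈ Sp, s.im = 0 ∧ 1 < s.re ∧ s.re ≤ 2)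
      (_ : ∀ g, DifferentiableOn ℂ (fun z => Ec z g) ({z : ℂ | 1 < z.re} \ (↑Sp : Set ℂ)))
      (_ : ∀ z : ℂ, 2 < z.re → Ec z = eisensteinSeriesU (flatSectionU φ z))
      (Fp : (quasiSplit (↥(maximalRealSubfield L)) L (IsCMField.complexConj L) 3).Adelic → ℂ → ℂ) (_ : ∀ g, AnalyticAt ℂ (Fp g) ((3 : ℂ) / 2))
      (_ : ∀ g, Fp g =ᶠ[𝓝[≠] ((3 : ℂ) / 2)] fun z => (z - (3 : ℂ) / 2) * Ec z g)
      (f : (quasiSplit (↥(maximalRealSubfield L)) L (IsCMField.complexConj L) 3).L2 μ) (_ : (f : (quasiSplit (↥(maximalRealSubfield L)) L (IsCMField.complexConj L) 3).automorphicQuotient → ℂ) =ᵐ[μ] fun x => Fp (Quotient.out (x : (quasiSplit (↥(maximalRealSubfield L)) L (IsCMField.complexConj L) 3).Adelic ⧸ (quasiSplit (↥(maximalRealSubfield L)) L (IsCMField.complexConj L) 3).quotientSubgroup))⁻¹ ((3 : ℂ) / 2)), (∀ z ∈ ({z : ℂ | 1 < z.re} \ (↑Sp : Set ℂ)), Continuous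 (Ec z)) ∧ (∀ z₁ ∈ ({z : ℂ | 1 < z.re} \ (↑Sp : Set ℂ)), ∀ K : Set (quasiSplit (↥(maximalRealSubfield L)) L (IsCMField.complexConj L) 3).Adelic, IsCompact K → ∃ V ∈ 𝓝 z₁, ∃ M : ℝ, ∀ z ∈ V, ∀ g ∈ K, ‖Ec z g‖ ≤ M))
    (hSCALτ : ∀ (U₀ : Subgroup ↥(finAdelic (↥(maximalRealSubfield L)) L (IsCMField.complexConj L) 3 ((StdForm.antidiagonal 3).over L))), IsTauLevel L U₀ →
      ∀ φ ∈ chiSectionSpacePair (ξ.bcη⁻¹ * ξ.bcψ⁻¹ * μω) ξ.ψ (tauLevel L U₀) ((1 : ↥(tauLevel L U₀) →* ℂ) : ↥(tauLevel L U₀) → ℂ), Continuous φ → IsArchFinite L φ →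
        ∀ (Ec : ℂ → (quasiSplit (↥(maximalRealSubfield L)) L (IsCMField.complexConj L) 3).Adelic → ℂ) (Sp : Finset ℂ), (∀ s ∈ Sp, s.im = 0 ∧ 1 < s.re ∧ s.re ≤ 2) →
          (∀ g, DifferentiableOn ℂ (fun z => Ec z g) ({z : ℂ | 1 < z.re} \ (↑Sp : Set ℂ))) → (∀ z : ℂ, 2 < z.re → Ec z = eisensteinSeriesU (flatSectionU φ z)) →
            ∀ g : (quasiSplit (↥(maximalRealSubfield L)) L (IsCMField.complexConj L) 3).Adelic, ∃ A : ℂ → ℂ, DifferentiableOn ℂ A {z : ℂ | 1 < z.re} ∧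
              ∀ z : ℂ, 2 < z.re → (borelConstantTerm ν₀ 𝓕₀ (Ec z) g - φ g * (((borelHeight g : ℝ≥0) : ℝ) : ℂ) ^ z) / (((borelHeight g : ℝ≥0) : ℝ) : ℂ) ^ (2 - z) = A z *
                ((partialStandardL S (fun w => {(ξ.bcη⁻¹ * μω).valueAtUniformizer w}) (z - 1) * partialStandardL T (fun v => {(1 : HeckeCharacter ↥(maximalRealSubfield L)).valueAtUniformizer v}) (2 * z - 2)) /
                  (partialStandardL S (fun w => {(ξ.bcη⁻¹ * μω).valueAtUniformizer w}) z * partialStandardL T (fun v => {(1 : HeckeCharacter ↥(maximalRealSubfield L)).valueAtUniformizer v}) (2 * z - 1))))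
    (hne : (resGMidBlockτ L μ ξ μω).toSubmodule ≠ ⊥) : LHalfNeZero (ξ.bcη⁻¹ * μω) := by
  by_contra hL
  exact hne (by rw [resGMidBlockτ_eq_bot_of_not_lHalfNeZero_of_record_v2 L μ ξ μω hφu hφA hS hurφ hT hurη hφ1 ν₀ h𝓕₀ h𝓕₀c h𝓕₀0 h𝓕₀top 𝔓 h𝔓 hRes hEXP hSCALτ hL,
    ClosedSubrep.toSubmodule_bot])

end Record

end Summit.HodgeConjecture.HodgeConjecture.R90.S8

end
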